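import Summits.QuantumFields.BalabanUV.T4Continuum.Support.ShellMeasurePlaquetteCubicCovBinders
import Summits.QuantumFields.BalabanUV.T4Continuum.Support.ShellMeasureCommutatorLevels

/-!
# `T4Continuum.ShellMeasurePlaquetteCubicAssembly` — row S65 f5d (part b, ONE GRID): (98) FOR THE ACTUAL ONE-GRID ACTION
# — `locGrad (Σ_p ord₃ plaqFunSym_p) = locGrad (cubT) + locGrad (Σ_p V0remCov_p)`, the `∇`-part (f5b) and the `∇`-free
# part (f2a∕f2c over f5d-a file 2's binders) ADDED by f2c `Prop4Hyp.add`: ONE `Prop4Hyp` from the source space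
# `max{|·|_{(−1)}, |∇·|_{(−2)}}`, COMPLETE at one grid
# (cell `pub-balaban`, sub-cell `t4`, spine estimate NE7c (node U5b), crew lineage `b2b-balaban-t4-ne7c-formalise-leaf-02`
# gen 8, owner table `LEAVES-NE7c-P1.md` row S65; imports this lineage's f5d-a file 2∕2
# `ShellMeasurePlaquetteCubicCovBinders` (p225058) and f5c `ShellMeasureCommutatorLevels` (p223561) ONLY; [folklore];
# 0 sorry, 0 def)

HONEST FRAMING.  Finite four-torus programme, rung (B)+1 only — NOT infinite volume, NOT a mass gap, NOT the Clay
problem, NOT summit progress; (B), `BetaPertHyp`, (B^μ) are not consumed.  NE7c (`T4IndicatorShell.ShellWeightBound`)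
is NOT PRINTED and NOT PROVED; «NE7c ⇐ the named binders» (WALL `t4/b2b-balaban-t4-ne7c-p1/WALL-NE7c-P1.md` §2).
ELEMENTARY bookkeeping ([folklore]); [Balaban1985Variational] (39)∕(97)∕(98) are LOCATORS for the shape only — the
paper is under adjudication; nothing printed is asserted or cited as a fact; no `def` is minted.
HONEST DEPENDENCY (cell): continuum YM on T⁴ ⇐ BetaPertH ∧ nine spine estimates (0/9 proved); BetaPertH ⇐ (D1) ∧ (D4)
∧ CAP+tail; G-an2-4 gates asym, D1 and NE2/3/4.

THE POINT.  END-II's (P4) binder is `hW : ∀ V, Prop4Hyp (W𝒱 V) C₄ a₃` ([Balaban1985Variational] Prop. 4 (97)∕(98) TYPE).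
Row S65 typed its two halves: the `∇`-PART `locGrad (cubT …)` (leaf-05-g7's kernel f3a–f3d → this lineage's f5a∕f5b at
one grid, f5c at the live levels, source space f2c `WMax`) and the `∇`-FREE PART `locGrad (Σ_p φ_p)` under a cubic
binder (f2b∕f2a∕f2c; binder discharged at one grid by leaf-03-g4's f4, in the covariant currency by f5d-a file 2
`hcub_V0remCov`).  File 1 of f5d-a proved `Σ_p ord₃ (plaqFunSym_p) = cubT (iη∕2) + Σ_p V0remCov_p`.  THIS FILE closes
the row's typing loop:
* §1 `locGrad_add` (the bond-local gradient is additive at points of differentiability), `prop4Hyp_congr`;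
* §2 `differentiable_sum_V0remCov`, **`locGrad_sum_ord₃_eq`**: `locGrad (Σ_p ord₃ plaqFunSym_p) A =
  locGrad (cubT Λ Pl (iη∕2) τ η U₀) A + locGrad (Σ_p V0remCov_p) A` for EVERY field `A` (both summands are entire);
* §3 ONE GRID, COMPLETE: **`prop4Hyp_locGrad_ord₃_oneGrid`** — for a finite family `Pl` of increasing plaquettes of
  b08's lattice containing every star, boundaries `bd p` in the finite bond set `Λ` oriented `(+, +, −, −)`, a
  `U1`-valued background with ONE regularity number `‖U₀(∂p) − 1‖ ≤ ε₀` on `Pl`, a tracial `τ`, `η > 0`, a field cap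
  `4ε ≤ 1`, an incidence bound `#st(b) ≤ m` and ANY `∇`-datum `Dv` dominating the covariant derivatives of the extended
  field: from `WMax 1 1 Dv` to `WSup 1 3 (𝔸 →L[ℂ] ℂ)`,
  `Prop4Hyp (Y ↦ locGrad (Σ_{p∈Pl} ord₃ (plaqFunSym τ U (bd p))) Y) (88(d−1)·η·‖τ‖ + 8·‖τ‖·(248∕3·ε₀ + 40∕3·ε)·m) (ε∕2)` —
  (97)∕(98) SHAPE for OUR one-grid Wilson action's order-≥3 part with EVERY hypothesis geometric∕displayed
  (f5b `prop4Hyp_locGrad_cubT_oneGrid` + f2c `prop4Hyp_locGrad_levels_max` at unit weights over `hcub_V0remCov` ∕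
  `V0remCov_add_single` ∕ `analyticOnNhd_V0remCov` + f2c `Prop4Hyp.add`).
NOT HERE: THE LIVE LEVELS — there the functional is the `η`-SCALED action `A′ ↦ η⁻⁴·Σ_p ord₃ plaqFunSym_p (η·A′)`
(J1 = leaf-03-g5's `ShellMeasureWilsonRemainderLevels.etaScale`, p225214: the `∇`-free family `etaScale η (V0remCov_p)`
under the per-plaquette regularity `‖U₀(∂p) − 1‖ ≤ ε₀(η∕W p)²`, f2b∕f2a∕f2c FIRED; `etaScale η (cubT (iη∕2)) = cubT (i∕2)`
makes f5c's `∇`-part `η`-FREE) — assembled in the follow-up `…AssemblyLevels` once J1's second file is in the tree; the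
identification of `Λ, Pl, wt, wd, Dv, U₀, η` with Bałaban's sectioned objects on `Ω_j` (node O ∕ [dict]); the
HD-dressing (S66).  So row S65's target — (98) for the (39)-split action between the weighted spaces — is KERNEL at one
grid here; no estimate of Bałaban's at a live level is discharged by citation.
-/

noncomputable section

open scoped BigOperators

namespace Summit.QuantumFields.BalabanUV.T4Continuum.ShellMeasurePlaquetteCubicAssembly

open Literature.MathematicalPhysics.QuantumFieldTheory.Balaban1983to89
open B7Prop1Explicit (e U1 mem_U1)
open B8Ineq132 (covDerivFwd)
open B11Prop6Scheme (Prop4Hyp)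
open ShellMeasureWilsonGradientTail (plaqWord bonds)
open ShellMeasurePlaquetteTwist (plaqFunSym analyticAt_plaqFunSym)
open ShellMeasurePlaquetteCubicLocal (analyticAt_ord₃)
open ShellMeasureLocalGradientTailJet (ord₃)
open Summit.QuantumFields.BalabanUV.T4Continuum.ShellMeasureCommutatorVariation (plaqStar)
open Summit.QuantumFields.BalabanUV.T4Continuum.ShellMeasureCommutatorGradientLocal (baseSites nbhdSites)
open Summit.QuantumFields.BalabanUV.T4Continuum.ShellMeasureCommutatorLocGrad (ext cubT differentiable_cubT)
open Summit.QuantumFields.BalabanUV.T4Continuum.ShellMeasureCommutatorCovDatum (unitW prop4Hyp_locGrad_cubT_oneGrid)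
open Summit.QuantumFields.BalabanUV.T4Continuum.ShellMeasureCommutatorLevels (prop4Hyp_locGrad_cubT_levels)
open Summit.QuantumFields.BalabanUV.T4Continuum.ShellMeasureLocalGradientTail (locGrad locGrad_apply sgl)
open Summit.QuantumFields.BalabanUV.T4Continuum.ShellMeasureMultiGridNorms
open Summit.QuantumFields.BalabanUV.T4Continuum.ShellMeasureMultiGridNormsMax
open Summit.QuantumFields.BalabanUV.T4Continuum.ShellMeasurePlaquetteCubicDictionary (V0remCov sum_ord₃_eq_cubT_add)
open Summit.QuantumFields.BalabanUV.T4Continuum.ShellMeasurePlaquetteCubicCovBinders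
  (hcub_V0remCov V0remCov_add_single analyticAt_V0remCov analyticOnNhd_V0remCov)

export B7Prop1Explicit (Site)

/-! ## §1 Two generic facts -/

section Generic

variable {Λ : Type*} [Fintype Λ] [DecidableEq Λ] {𝔄 : Type*} [NormedAddCommGroup 𝔄] [NormedSpace ℂ 𝔄]

/-- THE BOND-LOCAL GRADIENT IS ADDITIVE at a point where both functionals are differentiable. [folklore] -/
theorem locGrad_add {V₁ V₂ : (Λ → 𝔄) → ℂ} {A : Λ → 𝔄} (h₁ : DifferentiableAt ℂ V₁ A) (h₂ : DifferentiableAt ℂ V₂ A) :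
    locGrad (fun B => V₁ B + V₂ B) A = locGrad V₁ A + locGrad V₂ A := by
  funext b
  rw [Pi.add_apply, locGrad_apply, locGrad_apply, locGrad_apply,
    show (fun B => V₁ B + V₂ B) = V₁ + V₂ from rfl, fderiv_add h₁ h₂, ContinuousLinearMap.add_comp]

variable {𝒴 𝒵 : Type*} [NormedAddCommGroup 𝒴] [NormedSpace ℂ 𝒴] [NormedAddCommGroup 𝒵] [NormedSpace ℂ 𝒵]

omit [Fintype Λ] [DecidableEq Λ] [NormedAddCommGroup 𝔄] [NormedSpace ℂ 𝔄] in
/-- The (98) shape is a property of the map: pointwise-equal maps share it. [folklore] -/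
theorem prop4Hyp_congr {W W' : 𝒴 → 𝒵} {C a : ℝ} (h : Prop4Hyp W C a) (heq : ∀ Y, W' Y = W Y) :
    Prop4Hyp W' C a := by
  rw [show W' = W from funext heq]
  exact h

end Generic

/-! ## §2 The bond-local gradient of the actual action SPLITS -/

section Split

variable {d : ℕ} {𝔸 : Type*} [NormedRing 𝔸] [NormOneClass 𝔸] [NormedAlgebra ℂ 𝔸] [CompleteSpace 𝔸]
  (Λ : Finset (Site d × Fin d)) (Pl : Finset (Fin d × Fin d × Site d)) (τ : 𝔸 →L[ℂ] ℂ)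
  {U₀ : Site d → Fin d → 𝔸ˣ} (h₀ : ∀ y κ, U₀ y κ ∈ U1 𝔸) (bd : Fin d × Fin d × Site d → (Fin 4 → ↥Λ × Bool))
include h₀

omit [NormedAlgebra ℂ 𝔸] [CompleteSpace 𝔸] in
/-- The restricted background `U b := U₀ b.1 b.2` is unit-bounded. [folklore] -/
theorem restr_unit_bounded :
    (∀ b : ↥Λ, ‖((fun b : ↥Λ => U₀ b.1.1 b.1.2) b : 𝔸)‖ ≤ 1) ∧
      ∀ b : ↥Λ, ‖((((fun b : ↥Λ => U₀ b.1.1 b.1.2) b)⁻¹ : 𝔸ˣ) : 𝔸)‖ ≤ 1 :=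
  ⟨fun b => (mem_U1.1 (h₀ b.1.1 b.1.2)).1, fun b => (mem_U1.1 (h₀ b.1.1 b.1.2)).2⟩

/-- The `∇`-free family is entire (file 2 `analyticAt_V0remCov`), hence its sum is differentiable. [folklore] -/
theorem differentiable_sum_V0remCov :
    Differentiable ℂ fun A : ↥Λ → 𝔸 => ∑ p ∈ Pl, V0remCov τ (fun b : ↥Λ => U₀ b.1.1 b.1.2) (bd p) A := by
  obtain ⟨hU, hU'⟩ := restr_unit_bounded Λ h₀
  exact Differentiable.fun_sum fun p _ A => (analyticAt_V0remCov τ (bd p) hU hU' A).differentiableAt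

/-- The order-≥3 part of the action is entire, hence differentiable. [folklore] -/
theorem differentiable_sum_ord₃ :
    Differentiable ℂ fun A : ↥Λ → 𝔸 => ∑ p ∈ Pl, ord₃ (plaqFunSym τ (fun b : ↥Λ => U₀ b.1.1 b.1.2) (bd p)) A := by
  obtain ⟨hU, hU'⟩ := restr_unit_bounded Λ h₀
  exact Differentiable.fun_sum fun p _ A => (analyticAt_ord₃ (analyticAt_plaqFunSym hU hU' τ (bd p) A)).differentiableAt

/-- **THE SPLIT OF THE GRADIENT** ((39) differentiated, in b08's currency): for a tracial `τ`, `η ≠ 0` and boundaries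
`bd p` of the plaquettes `p = (μ, ν, x) ∈ Pl`, at EVERY field `A`:
`locGrad (Σ_p ord₃ plaqFunSym_p) A = locGrad (cubT Λ Pl (iη∕2) τ η U₀) A + locGrad (Σ_p V0remCov_p) A`. [folklore] -/
theorem locGrad_sum_ord₃_eq (htr : ∀ P Q : 𝔸, τ (P * Q) = τ (Q * P)) {η : ℝ} (hη : η ≠ 0)
    (hbd : ∀ p ∈ Pl, ((bd p 0).1 : Site d × Fin d) = (p.2.2, p.1) ∧ ((bd p 1).1 : Site d × Fin d) = (p.2.2 + e p.1, p.2.1)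
      ∧ ((bd p 2).1 : Site d × Fin d) = (p.2.2 + e p.2.1, p.1) ∧ ((bd p 3).1 : Site d × Fin d) = (p.2.2, p.2.1))
    (A : ↥Λ → 𝔸) :
    locGrad (fun A => ∑ p ∈ Pl, ord₃ (plaqFunSym τ (fun b : ↥Λ => U₀ b.1.1 b.1.2) (bd p)) A) A =
      locGrad (cubT Λ Pl (Complex.I * η / 2) τ η U₀) A
        + locGrad (fun A => ∑ p ∈ Pl, V0remCov τ (fun b : ↥Λ => U₀ b.1.1 b.1.2) (bd p) A) A := by
  have hfun : (fun A : ↥Λ → 𝔸 => ∑ p ∈ Pl, ord₃ (plaqFunSym τ (fun b : ↥Λ => U₀ b.1.1 b.1.2) (bd p)) A) =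
      fun A => cubT Λ Pl (Complex.I * η / 2) τ η U₀ A
        + ∑ p ∈ Pl, V0remCov τ (fun b : ↥Λ => U₀ b.1.1 b.1.2) (bd p) A :=
    funext fun A => sum_ord₃_eq_cubT_add Λ Pl τ U₀ bd htr hη hbd A
  rw [hfun]
  exact locGrad_add ((differentiable_cubT Λ Pl (Complex.I * η / 2) τ η U₀) A)
    ((differentiable_sum_V0remCov Λ Pl τ h₀ bd) A)

end Split

/-! ## §3 ONE GRID: (98) for the one-grid Wilson action's order-≥3 part, complete -/

section OneGrid

variable {d : ℕ} {𝔸 : Type*} [NormedRing 𝔸] [NormOneClass 𝔸] [NormedAlgebra ℂ 𝔸] [CompleteSpace 𝔸]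
  (Λ : Finset (Site d × Fin d)) (Pl : Finset (Fin d × Fin d × Site d)) (τ : 𝔸 →L[ℂ] ℂ)
  (bd : Fin d × Fin d × Site d → (Fin 4 → ↥Λ × Bool))

/-- `‖iη∕2‖ = η∕2` for `η > 0`. [folklore] -/
theorem norm_I_mul_div_two {η : ℝ} (hη : 0 < η) : ‖(Complex.I * η / 2 : ℂ)‖ = η / 2 := by
  rw [norm_div, norm_mul, Complex.norm_I, one_mul, Complex.norm_real, Real.norm_of_nonneg hη.le, RCLike.norm_ofNat]

/-- **THE `∇`-FREE PART AT ONE GRID** — f2c `prop4Hyp_locGrad_levels_max` at unit weights, FIRED on the family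
`V0remCov τ U (bd p)` over file 2's three binders: from `WMax 1 1 Dv` (any `∇`-datum `Dv`) to `WSup 1 3 (𝔸 →L[ℂ] ℂ)`,
`Prop4Hyp (…) (8·‖τ‖·(248∕3·ε₀ + 40∕3·ε)·m) (ε∕2)` for a `U1`-valued background with `‖U₀(∂p) − 1‖ ≤ ε₀` on `Pl`,
boundaries oriented `(+, +, −, −)`, a field cap `4ε ≤ 1` and an incidence bound `m`. [folklore] -/
theorem prop4Hyp_locGrad_sum_V0remCov_oneGrid {U₀ : Site d → Fin d → 𝔸ˣ} (h₀ : ∀ y κ, U₀ y κ ∈ U1 𝔸)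
    (hor : ∀ p ∈ Pl, (bd p 0).2 = true ∧ (bd p 1).2 = true ∧ (bd p 2).2 = false ∧ (bd p 3).2 = false)
    {I : Type*} [Fintype I] (Dv : (↥Λ → 𝔸) →L[ℂ] (I → 𝔸))
    {ε₀ ε : ℝ} (hε : 0 < ε) (hε4 : 4 * ε ≤ 1) (hε₀0 : 0 ≤ ε₀)
    (hε₀ : ∀ p ∈ Pl, ‖(plaqWord (fun b : ↥Λ => U₀ b.1.1 b.1.2) (bd p) (0 : ↥Λ → 𝔸) : 𝔸) - 1‖ ≤ ε₀)
    {m : ℕ} (hm : ∀ b : ↥Λ, (Pl.filter (fun p => b ∈ bonds (bd p))).card ≤ m) :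
    Prop4Hyp (fun Y : WMax (unitW ↥Λ) (unitW I) Dv =>
        ((WSup.toPiL (unitW ↥Λ) 3).symm
          (locGrad (fun A => ∑ p ∈ Pl, V0remCov τ (fun b : ↥Λ => U₀ b.1.1 b.1.2) (bd p) A)
            (WSup.toPiL (unitW ↥Λ) 1 (WMax.toWSupL (unitW ↥Λ) (unitW I) Dv Y))) : WSup (unitW ↥Λ) 3 (𝔸 →L[ℂ] ℂ)))
      (8 * (‖τ‖ * (248 / 3 * ε₀ + 40 / 3 * ε)) * m * 1 ^ 4) (ε / 2) := by
  obtain ⟨hU, hU'⟩ := restr_unit_bounded Λ h₀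
  have hκ : 0 ≤ ‖τ‖ * (248 / 3 * ε₀ + 40 / 3 * ε) := by positivity
  refine prop4Hyp_locGrad_levels_max (unitW ↥Λ) (unitW I) Dv Pl
    (fun p => V0remCov τ (fun b : ↥Λ => U₀ b.1.1 b.1.2) (bd p)) (fun p => bonds (bd p)) (fun _ => (1 : ℝ))
    hε hκ le_rfl (fun _ _ => one_pos) (fun _ _ b _ => ?_) (fun _ _ b _ => ?_) (fun p _ => ?_) (fun p hp A σ hσ0 hσ hA => ?_)
    (fun p _ A b hb X => V0remCov_add_single τ (bd p) hU hU' A hb X) hm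
  · simp
  · simp
  · exact analyticOnNhd_V0remCov τ (bd p) hU hU' _
  · obtain ⟨h0', h1', h2', h3'⟩ := hor p hp
    have hσ' : σ < ε := by simpa using hσ
    have h := hcub_V0remCov τ hU hU' (bd p) h0' h1' h2' h3' (hε₀ p hp) hε4 A σ hσ0 hσ' hA
    simpa using h

/-- **(98) FOR THE ONE-GRID WILSON ACTION'S ORDER-≥3 PART, COMPLETE.**  Data: a finite family `Pl` of INCREASING
plaquettes `(μ, ν, x)` of b08's lattice containing the star of every bond of the finite bond set `Λ`; boundaries `bd p`
with letters in `Λ`, those of `p_{μν}(x)`, oriented `(+, +, −, −)`; a `U1`-valued background `U₀` with ONE regularity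
number `‖U₀(∂p) − 1‖ ≤ ε₀` on `Pl`; a tracial `τ`; `η > 0`; a field cap `0 < ε`, `4ε ≤ 1`; an incidence bound
`#st(b) ≤ m`; ANY `∇`-datum `Dv` dominating the covariant derivatives of the extended field.  Conclusion, from f2c's
source space `WMax 1 1 Dv` (`max{sup_b ‖A b‖, sup_i ‖Dv A i‖}`) to `WSup 1 3 (𝔸 →L[ℂ] ℂ)`:
`Prop4Hyp (Y ↦ locGrad (Σ_{p∈Pl} ord₃ (plaqFunSym τ U (bd p))) Y) (88(d−1)·η·‖τ‖ + 8·‖τ‖·(248∕3·ε₀ + 40∕3·ε)·m) (ε∕2)`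
— [Balaban1985Variational] (97)∕(98) SHAPE for OUR one-grid action ((39)-split: `∇`-part f5b + `∇`-free part over
file 2's binders, added by f2c `Prop4Hyp.add`).  Nothing printed is asserted. [folklore] -/
theorem prop4Hyp_locGrad_ord₃_oneGrid {η : ℝ} (hη : 0 < η) {U₀ : Site d → Fin d → 𝔸ˣ}
    (h₀ : ∀ y κ, U₀ y κ ∈ U1 𝔸) (htr : ∀ P Q : 𝔸, τ (P * Q) = τ (Q * P)) (hincr : ∀ p ∈ Pl, p.1 < p.2.1)
    (hst : ∀ b : ↥Λ, plaqStar b.1.1 b.1.2 ⊆ Pl)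
    (hbd : ∀ p ∈ Pl, ((bd p 0).1 : Site d × Fin d) = (p.2.2, p.1) ∧ ((bd p 1).1 : Site d × Fin d) = (p.2.2 + e p.1, p.2.1)
      ∧ ((bd p 2).1 : Site d × Fin d) = (p.2.2 + e p.2.1, p.1) ∧ ((bd p 3).1 : Site d × Fin d) = (p.2.2, p.2.1))
    (hor : ∀ p ∈ Pl, (bd p 0).2 = true ∧ (bd p 1).2 = true ∧ (bd p 2).2 = false ∧ (bd p 3).2 = false)
    {I : Type*} [Fintype I] (Dv : (↥Λ → 𝔸) →L[ℂ] (I → 𝔸))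
    (hDv : ∀ (A : ↥Λ → 𝔸) (y : Site d) (κ τ' : Fin d), ‖covDerivFwd η U₀ κ (fun z => ext Λ A z τ') y‖ ≤ ‖Dv A‖)
    {ε₀ ε : ℝ} (hε : 0 < ε) (hε4 : 4 * ε ≤ 1) (hε₀0 : 0 ≤ ε₀)
    (hε₀ : ∀ p ∈ Pl, ‖(plaqWord (fun b : ↥Λ => U₀ b.1.1 b.1.2) (bd p) (0 : ↥Λ → 𝔸) : 𝔸) - 1‖ ≤ ε₀)
    {m : ℕ} (hm : ∀ b : ↥Λ, (Pl.filter (fun p => b ∈ bonds (bd p))).card ≤ m) :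
    Prop4Hyp (fun Y : WMax (unitW ↥Λ) (unitW I) Dv =>
        ((WSup.toPiL (unitW ↥Λ) 3).symm
          (locGrad (fun A => ∑ p ∈ Pl, ord₃ (plaqFunSym τ (fun b : ↥Λ => U₀ b.1.1 b.1.2) (bd p)) A)
            (WMax.toPiL (unitW ↥Λ) (unitW I) Dv Y)) : WSup (unitW ↥Λ) 3 (𝔸 →L[ℂ] ℂ)))
      (88 * ((d : ℝ) - 1) * η * ‖τ‖ + 8 * ‖τ‖ * (248 / 3 * ε₀ + 40 / 3 * ε) * m) (ε / 2) := by
  -- the two halves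
  have hgrad := prop4Hyp_locGrad_cubT_oneGrid Λ Pl (Complex.I * η / 2) hη h₀ htr hincr hst Dv hDv (ε / 2)
  have hfree := prop4Hyp_locGrad_sum_V0remCov_oneGrid Λ Pl τ bd h₀ hor Dv hε hε4 hε₀0 hε₀ hm
  have hsum := ShellMeasureMultiGridNormsMax.Prop4Hyp.add hgrad hfree
  -- same map
  have heq : ∀ Y : WMax (unitW ↥Λ) (unitW I) Dv,
      ((WSup.toPiL (unitW ↥Λ) 3).symm
          (locGrad (fun A => ∑ p ∈ Pl, ord₃ (plaqFunSym τ (fun b : ↥Λ => U₀ b.1.1 b.1.2) (bd p)) A)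
            (WMax.toPiL (unitW ↥Λ) (unitW I) Dv Y)) : WSup (unitW ↥Λ) 3 (𝔸 →L[ℂ] ℂ)) =
        ((fun Y : WMax (unitW ↥Λ) (unitW I) Dv =>
            ((WSup.toPiL (unitW ↥Λ) 3).symm
              (locGrad (cubT Λ Pl (Complex.I * η / 2) τ η U₀) (WMax.toPiL (unitW ↥Λ) (unitW I) Dv Y)) :
                WSup (unitW ↥Λ) 3 (𝔸 →L[ℂ] ℂ)))
          + fun Y : WMax (unitW ↥Λ) (unitW I) Dv =>
            ((WSup.toPiL (unitW ↥Λ) 3).symm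
              (locGrad (fun A => ∑ p ∈ Pl, V0remCov τ (fun b : ↥Λ => U₀ b.1.1 b.1.2) (bd p) A)
                (WSup.toPiL (unitW ↥Λ) 1 (WMax.toWSupL (unitW ↥Λ) (unitW I) Dv Y))) :
                  WSup (unitW ↥Λ) 3 (𝔸 →L[ℂ] ℂ))) Y := by
    intro Y
    have hid : WSup.toPiL (unitW ↥Λ) 1 (WMax.toWSupL (unitW ↥Λ) (unitW I) Dv Y) =
        WMax.toPiL (unitW ↥Λ) (unitW I) Dv Y := rfl
    rw [Pi.add_apply, hid, ← map_add, locGrad_sum_ord₃_eq Λ Pl τ h₀ bd htr hη.ne' hbd]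
  refine ShellMeasureMultiGridNormsMax.Prop4Hyp.mono (prop4Hyp_congr hsum heq) (le_of_eq ?_) le_rfl
  rw [norm_I_mul_div_two hη]
  ring

end OneGrid


end Summit.QuantumFields.BalabanUV.T4Continuum.ShellMeasurePlaquetteCubicAssembly

end
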